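/-
Copyright (c) 2026. All rights reserved.
Released under Apache 2.0 license as described in the file LICENSE.
-/
import Literature.Probability.LatticeModels.FourFunctionsEqualityBoolean
import Literature.Probability.LatticeModels.FKGEqualityLattice
import Mathlib.Order.SupClosed
import HarnessLib

/-!
# Equality in the Ahlswede–Daykin inequality on a finite distributive lattice (Chan–Pak 2026, Thm. 1.3)

[ChanPak2026] S. H. Chan and I. Pak, *Equality conditions for correlation inequalities*, arXiv:2607.06275
(2026), §1.2 and §8.2–8.3.

## Source, verbatim

**Definition 1.2 (cross-factoring)** (p. 2). "We say that four functions `a, b, c, d : L → ℝ≥0`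
*cross-factor* on a distributive lattice `L = (L, ∨, ∧)`, if there exists ◦ distributive lattices
`L₁ = (L₁, ∨′, ∧′)` and `L₂ = (L₂, ∨″, ∧″)`, ◦ functions `f₁, g₁ : L₁ → ℝ≥0` and `f₂, g₂ : L₂ → ℝ≥0`, and
◦ positive constants `α, β, γ, δ > 0`, such that: (1.1) `L ≃ L₁ × L₂`, `αβ = γδ`, and
(1.2) `a(x₁,x₂) = α f₁(x₁) f₂(x₂)`, `b(x₁,x₂) = β g₁(x₁) g₂(x₂)`, `c(x₁,x₂) = γ f₁(x₁) g₂(x₂)`,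
`d(x₁,x₂) = δ g₁(x₁) f₂(x₂)` for all `(x₁,x₂) ∈ L₁ × L₂`."  "Note that when four functions cross-factor
on `L`, we have an equality in (AD). Indeed, substituting (1.2) into (AD) splits each summation into a
product of two."  "For a function `f : L → ℝ≥0`, denote by `supp(f) := {x ∈ L : f(x) > 0}` the support
of `f`.  For a subset `S ⊆ L`, the *lattice closure* of `S` is the minimal sublattice of `L` that contains `S`."

**Theorem 1.3 (Equality conditions for the AD inequality)** (pp. 2–3). "Let `L = (L, ∨, ∧)` be a finite
distributive lattice.  Let `a, b, c, d : L → ℝ≥0` be four functions satisfying (AD-cond), and such that `L`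
is the lattice closure of `supp(a + b + c + d)`.  Then (AD) is an equality:
(AD-eq) `Σ_{x∈L} a(x) · Σ_{x∈L} b(x) = Σ_{x∈L} c(x) · Σ_{x∈L} d(x)`
if and only if functions `a, b, c, d` cross-factor on `L`."  Here (AD-cond) is
"`a(x) b(y) ≤ c(x ∨ y) d(x ∧ y)` for all `x, y ∈ L`" (p. 2).

**Remark 1.4** (p. 3). "The assumption that `L` is the lattice closure of `S := supp(a + b + c + d)` cannot
be omitted.  Indeed, without it, one could append a new maximum element `z` to `L`, creating an irreducible
lattice `L′`, and extend the four functions by letting `a(z) = b(z) = c(z) = d(z) = 0`."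

**Lemma 8.2 (Support product lemma)** (pp. 26–27) and **§8.3 Proof of Theorem 1.3** (pp. 27–28): embed
`L ↪ {0,1}^{J(L)}` by Birkhoff's theorem, extend `a, b, c, d` by zero, apply Theorem 8.1 on the Boolean
lattice (cross-factoring along a coordinate split `X₁ ⊔ X₂ = J(L)`), and show that the lattice closure of a
"product" support is the product of the closures ("by applying the same sequence of join/meet operations").

## What is formalised

* `CrossFactorOn a b c d` — Definition 1.2 verbatim (`L ≃o L₁ × L₂` an order isomorphism of lattices,
  which preserves `∨, ∧`; `f₁, g₁, f₂, g₂ ≥ 0`; `α, β, γ, δ > 0`; `αβ = γδ`; (1.2)).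
* `adEq_of_crossFactorOn` — the "clear" direction (⇐), for any real `a, b, c, d` (no hypothesis needed).
* `mix_mem_latticeClosure` — the combinatorial core of Lemma 8.2: in `2^P`, the lattice closure of a
  family closed under the coordinate exchange `(ω, ω′) ↦ (ω ∩ A) ∪ (ω′ ∖ A)` is again closed under it
  (the printed "apply the same sequence of join/wedge operations", as a closure induction).
* `crossFactorOn_of_adEq` (⇒) and `chanPak_thm13` (the iff) — Theorem 1.3.

Proof of (⇒), following §8.3 with the Boolean-lattice input `chanPak_thm51` + `crossFactor_of_crossEq`
(Theorems 5.1/8.1 of `FourFunctionsEqualityBoolean.lean`): Birkhoff `e : L ≃o 𝓛(P)` (`P` = join-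
irreducibles, Mathlib `OrderIso.lowerSetSupIrred`); the zero extensions `T a, …, T d : 2^P → ℝ≥0` satisfy
(AD-cond) and (AD-eq); Theorem 8.1 (non-degenerate case) gives `A ⊆ P` and `F₁, G₁` (read on `A`),
`F₂, G₂` (read off `A`) with positive constants.  The support of `T(a+b+c+d)` is then closed under the
exchange along `A`; by the lattice-closure hypothesis (transported with Mathlib `image_latticeClosure`) and
`mix_mem_latticeClosure`, the family of ALL lower sets of `P` is closed under the exchange, which forces `A`
to be both a lower and an upper set of `P`; hence `𝓛(P) ≃o 𝓛(A) × 𝓛(P ∖ A)`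
(`FKGEqualityLattice.lowerSetProdIso`, the isomorphism used for Thm. 1.6) and (1.2) is read off.  This
replaces the printed sublattices `L₁, L₂ ⊆ {0,1}^{X₁}, {0,1}^{X₂}` (lattice closures of the projected
supports) by the isomorphic `𝓛(A), 𝓛(P ∖ A)` — bookkeeping only; the mathematical step (closure of a
product support is a product) is the printed one.  Degenerate cases (`a ≡ 0` or `b ≡ 0`, hence `c ≡ 0` or
`d ≡ 0` by (AD-eq)) are the printed "without loss of generality … not identically zero" step, realised by
the trivial decompositions `L ≃ 1 × L`, `L ≃ L × 1`.

REMARKS ON THE PRINTED TEXT (recorded while formalising; they do not affect the result): in §8.3 (p. 27)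
the display after "It then follows from Theorem 8.1" reads `A = α F₁ G₂`, `B = β G₁ G₂`, `C = γ G₁ G₂`,
`D = δ G₁ F₂` in our text extraction of the arXiv PDF, where (8.1) gives `A = α F₁ F₂`, `B = β G₁ G₂`, `C = γ F₁ G₂`,
`D = δ G₁ F₂`; and (p. 28) "`L₂ := supp(F₁ + G₁)`" should read `supp(F₂ + G₂)`.  As for Theorem 8.1
itself, see the scope remark at `chanPak_thm81`.
-/

noncomputable section

open scoped Classical

namespace Literature.Probability.LatticeModels.FourFunctionsEquality

open Finset

open FKGEquality (mix DetBy)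

/-! ### Lemma 8.2: lattice closures of exchange-closed families in `2^P` -/

section MixClosure

variable {P : Type*}

/-- Membership in `mix`. [folklore] -/
private theorem mem_mix' {S ω β : Set P} {e : P} : e ∈ mix S ω β ↔ (e ∈ ω ∧ e ∈ S) ∨ (e ∈ β ∧ e ∉ S) := by
  simp only [mix, Set.mem_union, Set.mem_inter_iff, Set.mem_sdiff]

/-- `mix` is a join-homomorphism in its first configuration argument. [folklore] -/
private theorem mix_sup_left (A ω₁ ω₂ η : Set P) : mix A (ω₁ ⊔ ω₂) η = mix A ω₁ η ⊔ mix A ω₂ η := by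
  show mix A (ω₁ ∪ ω₂) η = mix A ω₁ η ∪ mix A ω₂ η
  ext e; simp only [mem_mix', Set.mem_union]; tauto

/-- `mix` is a meet-homomorphism in its first configuration argument. [folklore] -/
private theorem mix_inf_left (A ω₁ ω₂ η : Set P) : mix A (ω₁ ⊓ ω₂) η = mix A ω₁ η ⊓ mix A ω₂ η := by
  show mix A (ω₁ ∩ ω₂) η = mix A ω₁ η ∩ mix A ω₂ η
  ext e; simp only [mem_mix', Set.mem_inter_iff]; tauto

/-- `mix` is a join-homomorphism in its second configuration argument. [folklore] -/
private theorem mix_sup_right (A η ω₁ ω₂ : Set P) : mix A η (ω₁ ⊔ ω₂) = mix A η ω₁ ⊔ mix A η ω₂ := by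
  show mix A η (ω₁ ∪ ω₂) = mix A η ω₁ ∪ mix A η ω₂
  ext e; simp only [mem_mix', Set.mem_union]; tauto

/-- `mix` is a meet-homomorphism in its second configuration argument. [folklore] -/
private theorem mix_inf_right (A η ω₁ ω₂ : Set P) : mix A η (ω₁ ⊓ ω₂) = mix A η ω₁ ⊓ mix A η ω₂ := by
  show mix A η (ω₁ ∩ ω₂) = mix A η ω₁ ∩ mix A η ω₂
  ext e; simp only [mem_mix', Set.mem_inter_iff]; tauto

/-- A function determined by `A` reads only the `A`-part of a mixed configuration. [folklore] -/
private theorem detBy_mix_left {f : Set P → ℝ} {A : Set P} (hf : DetBy f A) (X Y : Set P) :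
    f (mix A X Y) = f X := by
  rw [hf (mix A X Y), hf X]; congr 1; ext e; simp only [Set.mem_inter_iff, mem_mix']; tauto

/-- A function determined by `Aᶜ` reads only the off-`A` part of a mixed configuration. [folklore] -/
private theorem detBy_mix_right {f : Set P → ℝ} {A : Set P} (hf : DetBy f Aᶜ) (X Y : Set P) :
    f (mix A X Y) = f Y := by
  rw [hf (mix A X Y), hf Y]; congr 1; ext e; simp only [Set.mem_inter_iff, mem_mix', Set.mem_compl_iff]; tauto

/-- **Support product lemma (the combinatorial core of Lemma 8.2).**  In the Boolean lattice `2^P` split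
along `A ⊔ (P ∖ A)`, write `mix A ω ω′ = (ω ∩ A) ∪ (ω′ ∖ A)` for the element `(ω₁, ω′₂)`.  If a family
`S ⊆ 2^P` is closed under `(ω, ω′) ↦ mix A ω ω′` (a "product" family `S = S₁ × S₂`), then so is its
lattice closure: the lattice closure of a product is the product of the lattice closures (printed proof:
"by applying the same sequence of join/wedge operations to these new elements").
[cite: ChanPak2026, Lemma 8.2 (proof)] -/
theorem mix_mem_latticeClosure {A : Set P} {S : Set (Set P)}
    (hS : ∀ ω ∈ S, ∀ ω' ∈ S, mix A ω ω' ∈ S) {ω ω' : Set P}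
    (hω : ω ∈ latticeClosure S) (hω' : ω' ∈ latticeClosure S) : mix A ω ω' ∈ latticeClosure S := by
  -- Step 1: one argument in `S`, the other in the closure
  have step1 : ∀ s ∈ S, ∀ ω ∈ latticeClosure S,
      mix A ω s ∈ latticeClosure S ∧ mix A s ω ∈ latticeClosure S := by
    intro s hs ω hω
    refine latticeClosure_sup_inf_induction (s := S)
      (fun ω _ => mix A ω s ∈ latticeClosure S ∧ mix A s ω ∈ latticeClosure S) ?_ ?_ ?_ hω
    · intro ω hωS
      exact ⟨subset_latticeClosure (hS ω hωS s hs), subset_latticeClosure (hS s hs ω hωS)⟩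
    · intro ω₁ _ ω₂ _ h₁ h₂
      refine ⟨?_, ?_⟩
      · rw [mix_sup_left]
        exact isSublattice_latticeClosure.supClosed h₁.1 h₂.1
      · rw [mix_sup_right]
        exact isSublattice_latticeClosure.supClosed h₁.2 h₂.2
    · intro ω₁ _ ω₂ _ h₁ h₂
      refine ⟨?_, ?_⟩
      · rw [mix_inf_left]
        exact isSublattice_latticeClosure.infClosed h₁.1 h₂.1
      · rw [mix_inf_right]
        exact isSublattice_latticeClosure.infClosed h₁.2 h₂.2
  -- Step 2: both arguments in the closure
  have step2 : ∀ ω' ∈ latticeClosure S, ∀ ω ∈ latticeClosure S,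
      mix A ω ω' ∈ latticeClosure S ∧ mix A ω' ω ∈ latticeClosure S := by
    intro ω' hω'
    refine latticeClosure_sup_inf_induction (s := S)
      (fun ω' _ => ∀ ω ∈ latticeClosure S, mix A ω ω' ∈ latticeClosure S ∧ mix A ω' ω ∈ latticeClosure S)
      ?_ ?_ ?_ hω'
    · intro s hs ω hω
      exact step1 s hs ω hω
    · intro ω₁ _ ω₂ _ h₁ h₂ ω hω
      refine ⟨?_, ?_⟩
      · rw [mix_sup_right]
        exact isSublattice_latticeClosure.supClosed (h₁ ω hω).1 (h₂ ω hω).1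
      · rw [mix_sup_left]
        exact isSublattice_latticeClosure.supClosed (h₁ ω hω).2 (h₂ ω hω).2
    · intro ω₁ _ ω₂ _ h₁ h₂ ω hω
      refine ⟨?_, ?_⟩
      · rw [mix_inf_right]
        exact isSublattice_latticeClosure.infClosed (h₁ ω hω).1 (h₂ ω hω).1
      · rw [mix_inf_left]
        exact isSublattice_latticeClosure.infClosed (h₁ ω hω).2 (h₂ ω hω).2
  exact (step2 ω' hω' ω hω).1

end MixClosure

/-! ### Definition 1.2 and Theorem 1.3 -/

section Lattice

universe u

variable {L : Type u} [DistribLattice L] [Fintype L]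

/-- **Cross-factoring (Definition 1.2).**  Four functions `a, b, c, d : L → ℝ≥0` *cross-factor* on the
finite distributive lattice `L` if there are distributive lattices `L₁, L₂` with `L ≃ L₁ × L₂` (an order
isomorphism of lattices; it preserves `∨, ∧`), functions `f₁, g₁ : L₁ → ℝ≥0`, `f₂, g₂ : L₂ → ℝ≥0` and
POSITIVE constants `α, β, γ, δ > 0` with `αβ = γδ` such that, writing `x = (x₁, x₂)`,
`a(x) = α f₁(x₁) f₂(x₂)`, `b(x) = β g₁(x₁) g₂(x₂)`, `c(x) = γ f₁(x₁) g₂(x₂)`, `d(x) = δ g₁(x₁) f₂(x₂)` (1.2).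
[cite: ChanPak2026, Definition 1.2] -/
def CrossFactorOn (a b c d : L → ℝ) : Prop :=
  ∃ (L₁ L₂ : Type u) (_ : DistribLattice L₁) (_ : Fintype L₁) (_ : DistribLattice L₂) (_ : Fintype L₂)
    (e : L ≃o L₁ × L₂) (f₁ g₁ : L₁ → ℝ) (f₂ g₂ : L₂ → ℝ) (α β γ δ : ℝ),
    (∀ y, 0 ≤ f₁ y) ∧ (∀ y, 0 ≤ g₁ y) ∧ (∀ z, 0 ≤ f₂ z) ∧ (∀ z, 0 ≤ g₂ z) ∧
    0 < α ∧ 0 < β ∧ 0 < γ ∧ 0 < δ ∧ α * β = γ * δ ∧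
    ∀ x, a x = α * f₁ (e x).1 * f₂ (e x).2 ∧ b x = β * g₁ (e x).1 * g₂ (e x).2 ∧
      c x = γ * f₁ (e x).1 * g₂ (e x).2 ∧ d x = δ * g₁ (e x).1 * f₂ (e x).2

/-- **Theorem 1.3 (⇐)** ("Note that when four functions cross-factor on `L`, we have an equality in (AD).
Indeed, substituting (1.2) into (AD) splits each summation into a product of two."); no hypothesis on
`a, b, c, d` is needed for this direction. [cite: ChanPak2026, §1.2 (after Def. 1.2), Thm. 1.3 (⇐)] -/
theorem adEq_of_crossFactorOn {a b c d : L → ℝ} (h : CrossFactorOn a b c d) :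
    (∑ x, a x) * ∑ x, b x = (∑ x, c x) * ∑ x, d x := by
  obtain ⟨L₁, L₂, _, _, _, _, e, f₁, g₁, f₂, g₂, α, β, γ, δ, -, -, -, -, -, -, -, -, hαβ, hX⟩ := h
  have key : ∀ (k : ℝ) (φ : L₁ → ℝ) (ψ : L₂ → ℝ),
      ∑ x, k * φ (e x).1 * ψ (e x).2 = k * ((∑ y, φ y) * ∑ z, ψ z) := by
    intro k φ ψ
    have h1 : ∑ x, k * φ (e x).1 * ψ (e x).2 = ∑ p : L₁ × L₂, k * φ p.1 * ψ p.2 :=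
      e.toEquiv.sum_comp (fun p : L₁ × L₂ => k * φ p.1 * ψ p.2)
    have h2 : ∑ p : L₁ × L₂, φ p.1 * ψ p.2 = (∑ y, φ y) * ∑ z, ψ z := by
      simp only [Fintype.sum_prod_type, Finset.sum_mul_sum]
    rw [h1, ← h2, Finset.mul_sum]
    exact Finset.sum_congr rfl fun p _ => by ring
  have hA : ∑ x, a x = α * ((∑ y, f₁ y) * ∑ z, f₂ z) := by
    rw [← key]; exact Finset.sum_congr rfl fun x _ => (hX x).1
  have hB : ∑ x, b x = β * ((∑ y, g₁ y) * ∑ z, g₂ z) := by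
    rw [← key]; exact Finset.sum_congr rfl fun x _ => (hX x).2.1
  have hC : ∑ x, c x = γ * ((∑ y, f₁ y) * ∑ z, g₂ z) := by
    rw [← key]; exact Finset.sum_congr rfl fun x _ => (hX x).2.2.1
  have hD : ∑ x, d x = δ * ((∑ y, g₁ y) * ∑ z, f₂ z) := by
    rw [← key]; exact Finset.sum_congr rfl fun x _ => (hX x).2.2.2
  rw [hA, hB, hC, hD]
  linear_combination ((∑ y, f₁ y) * (∑ z, f₂ z) * ((∑ y, g₁ y) * ∑ z, g₂ z)) * hαβ

/-- `L ≃o 1 × L` (trivial decomposition, first factor a point). [folklore] -/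
private def punitProdIso (L : Type u) [LE L] : L ≃o PUnit.{u+1} × L where
  toFun x := (PUnit.unit, x)
  invFun p := p.2
  left_inv _ := rfl
  right_inv _ := rfl
  map_rel_iff' := by
    intro a b
    exact Prod.mk_le_mk.trans (and_iff_right le_rfl)

/-- `L ≃o L × 1` (trivial decomposition, second factor a point). [folklore] -/
private def prodPUnitIso' (L : Type u) [LE L] : L ≃o L × PUnit.{u+1} where
  toFun x := (x, PUnit.unit)
  invFun p := p.1
  left_inv _ := rfl
  right_inv _ := rfl
  map_rel_iff' := by
    intro a b
    exact Prod.mk_le_mk.trans (and_iff_left le_rfl)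

/-- The degenerate cases of Theorem 1.3 (⇒): "Without loss of generality, assume that the functions
`a, b, c, d` are not identically equal to 0" (§8.3, referring to the proof of Thm. 8.1: "if `a = c = 0`, we
can set `A = ∅`, `f₁ = g₁ = 1`, `f₂ = d`, `g₂ = b` …  Other cases are analogous").  If `a ≡ 0` or `b ≡ 0`
then (AD-eq) forces `c ≡ 0` or `d ≡ 0`, and the trivial decompositions `L ≃ 1 × L`, `L ≃ L × 1` cross-factor.
[cite: ChanPak2026, §8.3 and proof of Thm. 8.1] -/
private theorem crossFactorOn_of_degenerate {a b c d : L → ℝ} (ha : ∀ x, 0 ≤ a x) (hb : ∀ x, 0 ≤ b x)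
    (hc : ∀ x, 0 ≤ c x) (hd : ∀ x, 0 ≤ d x) (heq : (∑ x, a x) * ∑ x, b x = (∑ x, c x) * ∑ x, d x)
    (h0 : (∀ x, a x = 0) ∨ ∀ x, b x = 0) : CrossFactorOn a b c d := by
  have hcd : (∀ x, c x = 0) ∨ ∀ x, d x = 0 := by
    have hzero : (∑ x, c x) * ∑ x, d x = 0 := by
      rw [← heq]
      rcases h0 with h | h
      · simp only [h, Finset.sum_const_zero, zero_mul]
      · simp only [h, Finset.sum_const_zero, mul_zero]
    rcases mul_eq_zero.1 hzero with h | h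
    · exact Or.inl fun x => (Finset.sum_eq_zero_iff_of_nonneg fun y _ => hc y).1 h x (Finset.mem_univ x)
    · exact Or.inr fun x => (Finset.sum_eq_zero_iff_of_nonneg fun y _ => hd y).1 h x (Finset.mem_univ x)
  rcases h0 with ha0 | hb0 <;> rcases hcd with hc0 | hd0
  · -- `a = c = 0`: `L ≃ 1 × L`, `f₁ = 0`, `g₁ = 1`, `f₂ = d`, `g₂ = b`
    refine ⟨PUnit.{u+1}, L, inferInstance, inferInstance, inferInstance, inferInstance, punitProdIso L,
      fun _ => 0, fun _ => 1, d, b, 1, 1, 1, 1, fun _ => le_rfl, fun _ => zero_le_one, hd, hb,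
      one_pos, one_pos, one_pos, one_pos, by ring, fun x => ⟨?_, ?_, ?_, ?_⟩⟩
    · show a x = 1 * 0 * d x
      rw [ha0 x]; ring
    · show b x = 1 * 1 * b x
      ring
    · show c x = 1 * 0 * b x
      rw [hc0 x]; ring
    · show d x = 1 * 1 * d x
      ring
  · -- `a = d = 0`: `L ≃ L × 1`, `f₁ = c`, `g₁ = b`, `f₂ = 0`, `g₂ = 1`
    refine ⟨L, PUnit.{u+1}, inferInstance, inferInstance, inferInstance, inferInstance, prodPUnitIso' L,
      c, b, fun _ => 0, fun _ => 1, 1, 1, 1, 1, hc, hb, fun _ => le_rfl, fun _ => zero_le_one,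
      one_pos, one_pos, one_pos, one_pos, by ring, fun x => ⟨?_, ?_, ?_, ?_⟩⟩
    · show a x = 1 * c x * 0
      rw [ha0 x]; ring
    · show b x = 1 * b x * 1
      ring
    · show c x = 1 * c x * 1
      ring
    · show d x = 1 * b x * 0
      rw [hd0 x]; ring
  · -- `b = c = 0`: `L ≃ L × 1`, `f₁ = a`, `g₁ = d`, `f₂ = 1`, `g₂ = 0`
    refine ⟨L, PUnit.{u+1}, inferInstance, inferInstance, inferInstance, inferInstance, prodPUnitIso' L,
      a, d, fun _ => 1, fun _ => 0, 1, 1, 1, 1, ha, hd, fun _ => zero_le_one, fun _ => le_rfl,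
      one_pos, one_pos, one_pos, one_pos, by ring, fun x => ⟨?_, ?_, ?_, ?_⟩⟩
    · show a x = 1 * a x * 1
      ring
    · show b x = 1 * d x * 0
      rw [hb0 x]; ring
    · show c x = 1 * a x * 0
      rw [hc0 x]; ring
    · show d x = 1 * d x * 1
      ring
  · -- `b = d = 0`: `L ≃ 1 × L`, `f₁ = 1`, `g₁ = 0`, `f₂ = a`, `g₂ = c`
    refine ⟨PUnit.{u+1}, L, inferInstance, inferInstance, inferInstance, inferInstance, punitProdIso L,
      fun _ => 1, fun _ => 0, a, c, 1, 1, 1, 1, fun _ => zero_le_one, fun _ => le_rfl, ha, hc,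
      one_pos, one_pos, one_pos, one_pos, by ring, fun x => ⟨?_, ?_, ?_, ?_⟩⟩
    · show a x = 1 * 1 * a x
      ring
    · show b x = 1 * 0 * c x
      rw [hb0 x]; ring
    · show c x = 1 * 1 * c x
      ring
    · show d x = 1 * 0 * a x
      rw [hd0 x]; ring

/-- **Theorem 1.3 (⇒), [ChanPak2026].**  Let `L` be a finite distributive lattice and `a, b, c, d : L → ℝ≥0`
satisfy (AD-cond) `a(x) b(y) ≤ c(x ∨ y) d(x ∧ y)`, with `L` the lattice closure of `supp(a + b + c + d)`
(Mathlib `latticeClosure`).  If `Σa · Σb = Σc · Σd` then `a, b, c, d` cross-factor on `L`.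
Proof = §8.3 of the source: Birkhoff embedding, zero extension, Theorem 8.1 on the Boolean lattice
(`chanPak_thm51` + `crossFactor_of_crossEq`), the support product Lemma 8.2 (`mix_mem_latticeClosure`);
the product decomposition is realised as `𝓛(P) ≃ 𝓛(A) × 𝓛(P ∖ A)` for the (bi-closed) coordinate set
`A` — see the module docstring. [cite: ChanPak2026, Thm. 1.3 (⇒), §8.3] -/
theorem crossFactorOn_of_adEq {a b c d : L → ℝ} (ha : ∀ x, 0 ≤ a x) (hb : ∀ x, 0 ≤ b x)
    (hc : ∀ x, 0 ≤ c x) (hd : ∀ x, 0 ≤ d x) (hAD : ∀ x y, a x * b y ≤ c (x ⊔ y) * d (x ⊓ y))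
    (hcl : latticeClosure {x | 0 < a x + b x + c x + d x} = Set.univ)
    (heq : (∑ x, a x) * ∑ x, b x = (∑ x, c x) * ∑ x, d x) : CrossFactorOn a b c d := by
  -- the degenerate cases
  by_cases hab : (∃ u, a u ≠ 0) ∧ ∃ v, b v ≠ 0
  swap
  · refine crossFactorOn_of_degenerate ha hb hc hd heq ?_
    by_contra h0
    push Not at h0
    exact hab ⟨h0.1, h0.2⟩
  obtain ⟨⟨u, hu⟩, ⟨v, hv⟩⟩ := hab
  haveI : Nonempty L := ⟨u⟩
  -- Birkhoff: `L ≃o 𝓛(P)`, `P` = join-irreducibles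
  letI : OrderBot L := Fintype.toOrderBot L
  obtain ⟨P, _, _, e⟩ : ∃ (P : Type u) (_ : PartialOrder P) (_ : Fintype P), Nonempty (L ≃o LowerSet P) :=
    ⟨{x : L // SupIrred x}, inferInstance, inferInstance, ⟨OrderIso.lowerSetSupIrred⟩⟩
  obtain ⟨e⟩ := e
  -- zero extension of functions on `L` to functions on `2^P` ("the unique extension", §8.2)
  obtain ⟨T, hT1, hT0⟩ : ∃ T : (L → ℝ) → Set P → ℝ,
      (∀ F ω (h : IsLowerSet ω), T F ω = F (e.symm ⟨ω, h⟩)) ∧ ∀ F ω, ¬IsLowerSet ω → T F ω = 0 :=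
    ⟨fun F ω => if h : IsLowerSet ω then F (e.symm ⟨ω, h⟩) else 0, fun F ω h => dif_pos h,
      fun F ω h => dif_neg h⟩
  have hTe : ∀ F x, T F (e x) = F x := fun F x => by
    rw [hT1 F _ (e x).lower]
    exact congrArg F (e.symm_apply_apply x)
  have hsum : ∀ G : Set P → ℝ, (∀ ω, ¬IsLowerSet ω → G ω = 0) → ∑ ω, G ω = ∑ x, G (e x) := by
    intro G hG
    rw [← Finset.sum_filter_of_ne (s := Finset.univ) (p := fun ω : Set P => IsLowerSet ω)
      (fun ω _ hne => by by_contra h; exact hne (hG ω h))]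
    symm
    refine Finset.sum_bij' (fun x _ => (e x : Set P)) (fun ω hω => e.symm ⟨ω, (Finset.mem_filter.1 hω).2⟩)
      (fun x _ => Finset.mem_filter.2 ⟨Finset.mem_univ _, (e x).lower⟩) (fun ω _ => Finset.mem_univ _)
      (fun x _ => ?_) (fun ω hω => ?_) (fun x _ => rfl)
    · exact e.symm_apply_apply x
    · simp only [OrderIso.apply_symm_apply, LowerSet.coe_mk]
  have hlin : ∀ F : L → ℝ, ∑ ω, T F ω = ∑ x, F x := fun F => by
    rw [hsum _ fun ω h => hT0 F ω h]
    exact Fintype.sum_congr _ _ fun x => hTe F x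
  have hT0le : ∀ F : L → ℝ, (∀ x, 0 ≤ F x) → ∀ ω, 0 ≤ T F ω := fun F hF ω => by
    by_cases h : IsLowerSet ω
    · rw [hT1 F ω h]; exact hF _
    · rw [hT0 F ω h]
  have hmk : ∀ (X Y : Set P) (hX : IsLowerSet X) (hY : IsLowerSet Y),
      (⟨X ∩ Y, hX.inter hY⟩ : LowerSet P) = ⟨X, hX⟩ ⊓ ⟨Y, hY⟩ ∧
        (⟨X ∪ Y, hX.union hY⟩ : LowerSet P) = ⟨X, hX⟩ ⊔ ⟨Y, hY⟩ := fun X Y hX hY =>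
    ⟨LowerSet.ext (by rw [LowerSet.coe_inf]; rfl), LowerSet.ext (by rw [LowerSet.coe_sup]; rfl)⟩
  -- the extended quadruple is AD on `2^P` and satisfies (AD-eq)
  have hq : IsAD (T a) (T b) (T c) (T d) := by
    refine ⟨hT0le a ha, hT0le b hb, hT0le c hc, hT0le d hd, fun X Y => ?_⟩
    by_cases hX : IsLowerSet X
    swap
    · rw [hT0 a X hX, zero_mul]; exact mul_nonneg (hT0le c hc _) (hT0le d hd _)
    by_cases hY : IsLowerSet Y
    swap
    · rw [hT0 b Y hY, mul_zero]; exact mul_nonneg (hT0le c hc _) (hT0le d hd _)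
    rw [hT1 a X hX, hT1 b Y hY, hT1 c _ (hX.union hY), hT1 d _ (hX.inter hY), (hmk X Y hX hY).1,
      (hmk X Y hX hY).2, e.symm.map_sup, e.symm.map_inf]
    exact hAD _ _
  have hADEq : ADEq (T a) (T b) (T c) (T d) := by
    unfold ADEq
    rw [hlin a, hlin b, hlin c, hlin d]
    exact heq
  -- Theorem 5.1 + Theorem 8.1 (non-degenerate case) on the Boolean lattice `2^P`
  obtain ⟨A, hA⟩ := (chanPak_thm51 hq).1 hADEq
  have hTa : ∃ U, T a U ≠ 0 := ⟨e u, by rw [hTe]; exact hu⟩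
  have hTb : ∃ V, T b V ≠ 0 := ⟨e v, by rw [hTe]; exact hv⟩
  obtain ⟨F₁, G₁, F₂, G₂, α, β, γ, δ, hF₁, hG₁, hF₂, hG₂, dF₁, dG₁, dF₂, dG₂, hα, hβ, hγ, hδ, hαβ, hX⟩ :=
    crossFactor_of_crossEq hq.ha hq.hb hq.hc hq.hd hA hTa hTb
  -- the constants are positive
  have hα' : 0 < α := lt_of_le_of_ne hα fun h0 => hu (by rw [← hTe a u, (hX (e u)).1, ← h0]; ring)
  have hβ' : 0 < β := lt_of_le_of_ne hβ fun h0 => hv (by rw [← hTe b v, (hX (e v)).2.1, ← h0]; ring)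
  have hγδ : 0 < γ * δ := by rw [← hαβ]; exact mul_pos hα' hβ'
  have hγ' : 0 < γ := lt_of_le_of_ne hγ fun h0 => by rw [← h0, zero_mul] at hγδ; exact lt_irrefl _ hγδ
  have hδ' : 0 < δ := lt_of_le_of_ne hδ fun h0 => by rw [← h0, mul_zero] at hγδ; exact lt_irrefl _ hγδ
  -- `H := T(a + b + c + d)` and its support, a product family along `A`
  obtain ⟨H, hH⟩ : ∃ H : Set P → ℝ, ∀ ω, H ω = T a ω + T b ω + T c ω + T d ω := ⟨_, fun _ => rfl⟩
  have hHe : ∀ x, H (e x) = a x + b x + c x + d x := fun x => by rw [hH, hTe, hTe, hTe, hTe]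
  have hHX : ∀ ω, H ω = α * (F₁ ω * F₂ ω) + β * (G₁ ω * G₂ ω) + γ * (F₁ ω * G₂ ω) + δ * (G₁ ω * F₂ ω) :=
    fun ω => by rw [hH, (hX ω).1, (hX ω).2.1, (hX ω).2.2.1, (hX ω).2.2.2]; ring
  have hHlower : ∀ ω, H ω ≠ 0 → IsLowerSet ω := fun ω hω => by
    by_contra hnl
    apply hω
    rw [hH, hT0 a ω hnl, hT0 b ω hnl, hT0 c ω hnl, hT0 d ω hnl]
    ring
  -- support criterion: `H(ω) > 0 ⟺ (F₁ + G₁)(ω₁) > 0 and (F₂ + G₂)(ω₂) > 0`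
  have hcrit : ∀ ω, 0 < H ω → 0 < F₁ ω + G₁ ω ∧ 0 < F₂ ω + G₂ ω := by
    intro ω hpos
    have h1 : α * (F₁ ω * F₂ ω) ≤ (α + β + γ + δ) * (F₁ ω * F₂ ω) :=
      mul_le_mul_of_nonneg_right (by linarith) (mul_nonneg (hF₁ ω) (hF₂ ω))
    have h2 : β * (G₁ ω * G₂ ω) ≤ (α + β + γ + δ) * (G₁ ω * G₂ ω) :=
      mul_le_mul_of_nonneg_right (by linarith) (mul_nonneg (hG₁ ω) (hG₂ ω))
    have h3 : γ * (F₁ ω * G₂ ω) ≤ (α + β + γ + δ) * (F₁ ω * G₂ ω) :=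
      mul_le_mul_of_nonneg_right (by linarith) (mul_nonneg (hF₁ ω) (hG₂ ω))
    have h4 : δ * (G₁ ω * F₂ ω) ≤ (α + β + γ + δ) * (G₁ ω * F₂ ω) :=
      mul_le_mul_of_nonneg_right (by linarith) (mul_nonneg (hG₁ ω) (hF₂ ω))
    have hexp : (α + β + γ + δ) * ((F₁ ω + G₁ ω) * (F₂ ω + G₂ ω)) =
        (α + β + γ + δ) * (F₁ ω * F₂ ω) + (α + β + γ + δ) * (G₁ ω * G₂ ω) +
          (α + β + γ + δ) * (F₁ ω * G₂ ω) + (α + β + γ + δ) * (G₁ ω * F₂ ω) := by ring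
    have hle : H ω ≤ (α + β + γ + δ) * ((F₁ ω + G₁ ω) * (F₂ ω + G₂ ω)) := by
      rw [hexp, hHX]; linarith
    have hM : 0 < α + β + γ + δ := by linarith
    have hprod : 0 < (F₁ ω + G₁ ω) * (F₂ ω + G₂ ω) := by
      have h' : (α + β + γ + δ) * 0 < (α + β + γ + δ) * ((F₁ ω + G₁ ω) * (F₂ ω + G₂ ω)) := by
        rw [mul_zero]; exact lt_of_lt_of_le hpos hle
      exact lt_of_mul_lt_mul_left h' hM.le
    have hK₁ : 0 ≤ F₁ ω + G₁ ω := add_nonneg (hF₁ ω) (hG₁ ω)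
    have hK₂ : 0 ≤ F₂ ω + G₂ ω := add_nonneg (hF₂ ω) (hG₂ ω)
    refine ⟨lt_of_le_of_ne hK₁ fun h0 => ?_, lt_of_le_of_ne hK₂ fun h0 => ?_⟩
    · rw [← h0, zero_mul] at hprod; exact lt_irrefl _ hprod
    · rw [← h0, mul_zero] at hprod; exact lt_irrefl _ hprod
  have hlow : ∀ ω, 0 < (F₁ ω + G₁ ω) * (F₂ ω + G₂ ω) → 0 < H ω := by
    intro ω hpos
    set m := min (min α β) (min γ δ) with hm_def
    have hm : 0 < m := lt_min (lt_min hα' hβ') (lt_min hγ' hδ')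
    have hmα : m ≤ α := (min_le_left _ _).trans (min_le_left _ _)
    have hmβ : m ≤ β := (min_le_left _ _).trans (min_le_right _ _)
    have hmγ : m ≤ γ := (min_le_right _ _).trans (min_le_left _ _)
    have hmδ : m ≤ δ := (min_le_right _ _).trans (min_le_right _ _)
    have h1 : m * (F₁ ω * F₂ ω) ≤ α * (F₁ ω * F₂ ω) :=
      mul_le_mul_of_nonneg_right hmα (mul_nonneg (hF₁ ω) (hF₂ ω))
    have h2 : m * (G₁ ω * G₂ ω) ≤ β * (G₁ ω * G₂ ω) :=
      mul_le_mul_of_nonneg_right hmβ (mul_nonneg (hG₁ ω) (hG₂ ω))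
    have h3 : m * (F₁ ω * G₂ ω) ≤ γ * (F₁ ω * G₂ ω) :=
      mul_le_mul_of_nonneg_right hmγ (mul_nonneg (hF₁ ω) (hG₂ ω))
    have h4 : m * (G₁ ω * F₂ ω) ≤ δ * (G₁ ω * F₂ ω) :=
      mul_le_mul_of_nonneg_right hmδ (mul_nonneg (hG₁ ω) (hF₂ ω))
    have hexp : m * ((F₁ ω + G₁ ω) * (F₂ ω + G₂ ω)) =
        m * (F₁ ω * F₂ ω) + m * (G₁ ω * G₂ ω) + m * (F₁ ω * G₂ ω) + m * (G₁ ω * F₂ ω) := by ring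
    calc 0 < m * ((F₁ ω + G₁ ω) * (F₂ ω + G₂ ω)) := mul_pos hm hpos
      _ ≤ H ω := by rw [hexp, hHX]; linarith
  -- the support of `a + b + c + d`, read in `2^P`, is closed under the exchange along `A`
  have hcl' : ∀ x x' : L, 0 < a x + b x + c x + d x → 0 < a x' + b x' + c x' + d x' →
      ∃ y : L, 0 < a y + b y + c y + d y ∧ (e y : Set P) = mix A (e x) (e x') := by
    intro x x' hx hx'
    have hK₁ := (hcrit (e x) (by rw [hHe]; exact hx)).1
    have hK₂ := (hcrit (e x') (by rw [hHe]; exact hx')).2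
    have hHm : 0 < H (mix A (e x : Set P) (e x')) := by
      apply hlow
      rw [detBy_mix_left dF₁, detBy_mix_left dG₁, detBy_mix_right dF₂, detBy_mix_right dG₂]
      exact mul_pos hK₁ hK₂
    have hml : IsLowerSet (mix A (e x : Set P) (e x')) := hHlower _ hHm.ne'
    refine ⟨e.symm ⟨_, hml⟩, ?_, ?_⟩
    · rw [← hHe, OrderIso.apply_symm_apply]; exact hHm
    · simp only [OrderIso.apply_symm_apply, LowerSet.coe_mk]
  -- transport of the lattice-closure hypothesis along Birkhoff: every lower set of `P` lies in the
  -- lattice closure of the (image of the) support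
  have hms : ∀ x y : L, ((e (x ⊔ y) : LowerSet P) : Set P) = (e x : Set P) ⊔ (e y : Set P) :=
    fun x y => by rw [e.map_sup]; exact LowerSet.coe_sup _ _
  have hmi : ∀ x y : L, ((e (x ⊓ y) : LowerSet P) : Set P) = (e x : Set P) ⊓ (e y : Set P) :=
    fun x y => by rw [e.map_inf]; exact LowerSet.coe_inf _ _
  obtain ⟨S', hS'⟩ : ∃ S' : Set (Set P),
      S' = (fun x : L => (e x : Set P)) '' {x | 0 < a x + b x + c x + d x} := ⟨_, rfl⟩
  have hrange : ∀ ω : Set P, IsLowerSet ω → ω ∈ latticeClosure S' := by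
    intro ω hω
    have himg := image_latticeClosure {x : L | 0 < a x + b x + c x + d x} (fun x : L => (e x : Set P))
      hms hmi
    rw [hcl, Set.image_univ, ← hS'] at himg
    rw [← himg]
    exact ⟨e.symm ⟨ω, hω⟩, by simp only [OrderIso.apply_symm_apply, LowerSet.coe_mk]⟩
  have hS'mix : ∀ η ∈ S', ∀ η' ∈ S', mix A η η' ∈ S' := by
    rw [hS']
    rintro _ ⟨x, hx, rfl⟩ _ ⟨x', hx', rfl⟩
    obtain ⟨y, hy, hye⟩ := hcl' x x' hx hx'
    exact ⟨y, hy, hye⟩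
  have hlowSub : IsSublattice {ω : Set P | IsLowerSet ω} :=
    ⟨fun _ hω _ hω' => IsLowerSet.union hω hω', fun _ hω _ hω' => IsLowerSet.inter hω hω'⟩
  have hS'low : S' ⊆ {ω : Set P | IsLowerSet ω} := by
    rw [hS']
    rintro _ ⟨x, -, rfl⟩
    exact (e x).lower
  -- Lemma 8.2: the family of all lower sets (= the closure of the support) is exchange-closed along `A`
  have hmixLower : ∀ ω ω' : Set P, IsLowerSet ω → IsLowerSet ω' → IsLowerSet (mix A ω ω') :=
    fun ω ω' hω hω' =>
      latticeClosure_min hS'low hlowSub (mix_mem_latticeClosure hS'mix (hrange ω hω) (hrange ω' hω'))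
  -- hence `A` is a lower and an upper set of `P`
  have hAl : IsLowerSet A := by
    intro p q hqp hp
    have hl := hmixLower (Set.Iic p) ∅ (isLowerSet_Iic p) isLowerSet_empty
    have hpm : p ∈ mix A (Set.Iic p) ∅ := mem_mix'.2 (Or.inl ⟨Set.mem_Iic.2 le_rfl, hp⟩)
    rcases mem_mix'.1 (hl hqp hpm) with ⟨-, hqA⟩ | ⟨hq0, -⟩
    · exact hqA
    · exact absurd hq0 (Set.notMem_empty q)
  have hAu : IsUpperSet A := by
    intro p q hpq hp
    by_contra hq
    have hl := hmixLower ∅ (Set.Iic q) isLowerSet_empty (isLowerSet_Iic q)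
    have hqm : q ∈ mix A ∅ (Set.Iic q) := mem_mix'.2 (Or.inr ⟨Set.mem_Iic.2 le_rfl, hq⟩)
    rcases mem_mix'.1 (hl hpq hqm) with ⟨hp0, -⟩ | ⟨-, hpA⟩
    · exact absurd hp0 (Set.notMem_empty p)
    · exact hpA hp
  -- the product decomposition `L ≃ 𝓛(P) ≃ 𝓛(A) × 𝓛(P ∖ A)` and the factors
  haveI : Finite (LowerSet A) := Finite.of_injective (fun D : LowerSet A => (D : Set A)) SetLike.coe_injective
  haveI : Finite (LowerSet ↥Aᶜ) :=
    Finite.of_injective (fun D : LowerSet ↥Aᶜ => (D : Set ↥Aᶜ)) SetLike.coe_injective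
  letI : Fintype (LowerSet A) := Fintype.ofFinite _
  letI : Fintype (LowerSet ↥Aᶜ) := Fintype.ofFinite _
  have h1 : ∀ F : Set P → ℝ, DetBy F A → ∀ x : L,
      F (e x) = F (Subtype.val '' (Subtype.val ⁻¹' (e x : Set P) : Set A)) := fun F hF x => by
    rw [Subtype.image_preimage_coe, Set.inter_comm]; exact hF _
  have h2 : ∀ F : Set P → ℝ, DetBy F Aᶜ → ∀ x : L,
      F (e x) = F (Subtype.val '' (Subtype.val ⁻¹' (e x : Set P) : Set ↥Aᶜ)) := fun F hF x => by
    rw [Subtype.image_preimage_coe, Set.inter_comm]; exact hF _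
  refine ⟨LowerSet A, LowerSet ↥Aᶜ, inferInstance, inferInstance, inferInstance, inferInstance,
    e.trans (FKGEqualityLattice.lowerSetProdIso A hAl hAu),
    fun D => F₁ (Subtype.val '' (D : Set A)), fun D => G₁ (Subtype.val '' (D : Set A)),
    fun D => F₂ (Subtype.val '' (D : Set ↥Aᶜ)), fun D => G₂ (Subtype.val '' (D : Set ↥Aᶜ)),
    α, β, γ, δ, fun _ => hF₁ _, fun _ => hG₁ _, fun _ => hF₂ _, fun _ => hG₂ _, hα', hβ', hγ', hδ', hαβ,
    fun x => ⟨?_, ?_, ?_, ?_⟩⟩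
  · show a x = α * F₁ (Subtype.val '' (Subtype.val ⁻¹' (e x : Set P) : Set A)) *
      F₂ (Subtype.val '' (Subtype.val ⁻¹' (e x : Set P) : Set ↥Aᶜ))
    rw [← h1 F₁ dF₁, ← h2 F₂ dF₂, ← hTe a x]; exact (hX (e x)).1
  · show b x = β * G₁ (Subtype.val '' (Subtype.val ⁻¹' (e x : Set P) : Set A)) *
      G₂ (Subtype.val '' (Subtype.val ⁻¹' (e x : Set P) : Set ↥Aᶜ))
    rw [← h1 G₁ dG₁, ← h2 G₂ dG₂, ← hTe b x]; exact (hX (e x)).2.1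
  · show c x = γ * F₁ (Subtype.val '' (Subtype.val ⁻¹' (e x : Set P) : Set A)) *
      G₂ (Subtype.val '' (Subtype.val ⁻¹' (e x : Set P) : Set ↥Aᶜ))
    rw [← h1 F₁ dF₁, ← h2 G₂ dG₂, ← hTe c x]; exact (hX (e x)).2.2.1
  · show d x = δ * G₁ (Subtype.val '' (Subtype.val ⁻¹' (e x : Set P) : Set A)) *
      F₂ (Subtype.val '' (Subtype.val ⁻¹' (e x : Set P) : Set ↥Aᶜ))
    rw [← h1 G₁ dG₁, ← h2 F₂ dF₂, ← hTe d x]; exact (hX (e x)).2.2.2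

/-- **Theorem 1.3 (Equality conditions for the AD inequality), [ChanPak2026].**  Let `L` be a finite
distributive lattice, `a, b, c, d : L → ℝ≥0` four functions satisfying (AD-cond), and such that `L` is the
lattice closure of `supp(a + b + c + d)`.  Then `Σa · Σb = Σc · Σd` (AD-eq) holds if and only if `a, b, c, d`
cross-factor on `L` (Definition 1.2). [cite: ChanPak2026, Thm. 1.3] -/
theorem chanPak_thm13 {a b c d : L → ℝ} (ha : ∀ x, 0 ≤ a x) (hb : ∀ x, 0 ≤ b x) (hc : ∀ x, 0 ≤ c x)
    (hd : ∀ x, 0 ≤ d x) (hAD : ∀ x y, a x * b y ≤ c (x ⊔ y) * d (x ⊓ y))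
    (hcl : latticeClosure {x | 0 < a x + b x + c x + d x} = Set.univ) :
    (∑ x, a x) * ∑ x, b x = (∑ x, c x) * ∑ x, d x ↔ CrossFactorOn a b c d :=
  ⟨crossFactorOn_of_adEq ha hb hc hd hAD hcl, adEq_of_crossFactorOn⟩

end Lattice

end Literature.Probability.LatticeModels.FourFunctionsEquality

end
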